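import Literature.NumberTheory.Automorphic.UnitaryThreeTorusBlockElements        -- ★ γ2b-A p841319 (+ γ2a, γ0, B-p04 p841018, (F1))
import Literature.NumberTheory.Automorphic.UnitaryThreeDoubleCosetsHKDefs         -- ★ B-p17 DEFS: `flickerKH`
import HarnessLib

/-!
# Flicker's Proposition 6 (b) in the `U(Φ₃)` frame: the double cosets `T_H^θ · diag(ϖ^{−i},1,ϖ^{i}) · K_H` are pairwise distinct
(Flicker (1998), *Elementary proof of the fundamental lemma for a unitary group*, Prop. 6 p. 83)

Topic `NumberTheory/Automorphic`; namespace `Literature.NumberTheory.Automorphic.UnitaryGroup`.  KERNEL mathematics only: theorems, no definition, no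
named fact, no instance, no notation, no `sorry`.  Cell `pub/hodgecm-mathlib`, programme P3a, road «D-N7-inert», MAP v3 «N7-ns COUNT FROM FLICKER», brick
(F3c-γ) «LATTICE ↔ COSET TRANSPORT» FILE γ2b-C = the binder `hB` of ★ B-p04 (g33) p840967 `FixedPointsTorusDoubleCosetCount` at `G := ↥H`,
`T := Z_H(t_θ)`, `K := flickerKH.subgroupOf H`, `r i := diag(ϖ^{−i}, 1, ϖ^{i})` (LEAD F0P3a-plan (g9) T8-60 (C); architect A-p06 (g26)).
HC_CM is proved only modulo the printed citations (2 remaining named inputs hLiu418, h413) until rung 0 closes; this file discharges no named fact.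

MATHEMATICS (elementary, by valuations — no lattice needed).  If `τ r_i k = τ′ r_j k′` then `r_i = σ₀ · r_j · κ` with `σ₀ = τ⁻¹τ′ ∈ Z_H(t)` (corner
`(p, θ²q; q, p)` by ★ `mem_centralizer_block_iff`, `Bθ′ = Cθ`) and `κ = k′k⁻¹ ∈ K_H` (integral corner `(a b; c e)` with `|ae − bc| = 1` by ★ γ0).
Reading the four corner entries of `r_i = σ₀ r_j κ`: `a = ϖ^{j−i}·p·Δ`, `e = ϖ^{i−j}·p·Δ`, `c = −ϖ^{−i−j}·q·Δ` (`Δ = ae − bc`), whence for `i ≠ j`: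
`|p| < 1` and `|θ q| < 1`, contradicting `|p² − θ²q²| = |Δ|⁻¹ = 1`.  Hence `i = j`.

References: [Flicker1998UnitaryFL] Y. Z. Flicker, Canad. J. Math. 50 (1998), Prop. 6 p. 83 · [Rogawski1990] J. D. Rogawski, Ann. of Math. Stud. 123, §4.9 p. 55. -/

set_option autoImplicit false

open Matrix
open scoped MatrixGroups WithZero

namespace Literature.NumberTheory.Automorphic.UnitaryGroup

open Literature.NumberTheory.Automorphic.HermitianLattice (unitaryInt LocalConjDatum)

variable {K : Type*} [Field K] [Valued K ℤᵐ⁰] {ϖ : K} (σ : K →+* K) {J : Matrix (Fin 3) (Fin 3) K}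
  (hJ : J = (StdForm.antidiagonal 3).over K) (hd : LocalConjDatum σ ϖ)

/-- `|x| ≤ |ϖ|^n · c`-type bookkeeping: `|ϖ^n| < 1` for `n ≥ 1`. [cite: Flicker1998UnitaryFL, Prop. 6 p. 83] -/
theorem v_pow_lt_one (hϖ : Valued.v ϖ = WithZero.exp (-1 : ℤ)) {n : ℕ} (hn : 1 ≤ n) : Valued.v (ϖ ^ n) < 1 := by
  rw [map_pow, hϖ, ← WithZero.exp_nsmul, ← WithZero.exp_zero, WithZero.exp_lt_exp]
  simp only [nsmul_eq_mul, mul_neg, mul_one, Left.neg_neg_iff]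
  exact_mod_cast hn

set_option maxHeartbeats 800000 in
-- explicit block computation + valuation case analysis
include hJ hd in
/-- **FLICKER'S PROPOSITION 6 (b) — THE DOUBLE COSETS `T_H^θ · r_i · K_H` ARE PAIRWISE DISTINCT** (`r_i = diag(ϖ^{−i},1,ϖ^{i})`,
`T_H^θ = Z_H(t)` for a regular torus block `t = !![A,0,B;0,b,0;C,0,A]`, `C ≠ 0`, `Bθ′ = Cθ`, `θ = ϖ^ε`): `τ r_i k = τ′ r_j k′ ⇒ i = j` — the binder `hB`
of ★ `FixedPointsTorusDoubleCosetCount` VERBATIM at `G := ↥H`. [cite: Flicker1998UnitaryFL, Prop. 6 p. 83] -/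
theorem eq_of_centralizer_mul_diagRadial_mul_flickerKH_eq
    {c : ↥(unitaryGroupOfForm σ J)} (hc : ((c : GL (Fin 3) K) : Matrix (Fin 3) (Fin 3) K) = !![1, 0, 0; 0, -1, 0; 0, 0, 1])
    {θ θ' : K} {ε : ℕ} (hθε : θ = ϖ ^ ε) (hθ : θ * θ' = 1)
    {t : ↥(unitaryGroupOfForm σ J)} (htH : t ∈ Subgroup.centralizer ({c} : Set ↥(unitaryGroupOfForm σ J))) {A B C b₀ : K}
    (hte : ((t : GL (Fin 3) K) : Matrix (Fin 3) (Fin 3) K) = !![A, 0, B; 0, b₀, 0; C, 0, A]) (hC : C ≠ 0) (hBC : B * θ' = C * θ)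
    (r : ℕ → ↥(Subgroup.centralizer ({c} : Set ↥(unitaryGroupOfForm σ J))))
    (hr : ∀ i, (((r i : ↥(unitaryGroupOfForm σ J)) : GL (Fin 3) K) : Matrix (Fin 3) (Fin 3) K) = !![(ϖ ^ i)⁻¹, 0, 0; 0, 1, 0; 0, 0, ϖ ^ i]) :
    ∀ i j : ℕ, ∀ τ ∈ Subgroup.centralizer ({⟨t, htH⟩} : Set ↥(Subgroup.centralizer ({c} : Set ↥(unitaryGroupOfForm σ J)))),
      ∀ τ' ∈ Subgroup.centralizer ({⟨t, htH⟩} : Set ↥(Subgroup.centralizer ({c} : Set ↥(unitaryGroupOfForm σ J)))),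
      ∀ k ∈ (flickerKH σ J c).subgroupOf (Subgroup.centralizer ({c} : Set ↥(unitaryGroupOfForm σ J))),
      ∀ k' ∈ (flickerKH σ J c).subgroupOf (Subgroup.centralizer ({c} : Set ↥(unitaryGroupOfForm σ J))),
      τ * r i * k = τ' * r j * k' → i = j := by
  intro i j τ hτ τ' hτ' k hk k' hk' heq
  classical
  -- scalar facts
  have h2 : (2 : K) ≠ 0 := fun h0 => by have := hd.v2; rw [h0, map_zero] at this; exact zero_ne_one this
  have hϖ0 : ϖ ≠ 0 := fun h0 => by have := hd.vϖ; rw [h0, map_zero] at this; exact WithZero.zero_ne_coe this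
  have hθ0 : θ ≠ 0 := by rw [hθε]; exact pow_ne_zero _ hϖ0
  have hvθ : Valued.v θ ≤ 1 := by
    rw [hθε, map_pow, hd.vϖ, ← WithZero.exp_nsmul, ← WithZero.exp_zero, WithZero.exp_le_exp]; simp
  have hθ'e : θ' = θ⁻¹ := (inv_eq_of_mul_eq_one_right hθ).symm
  have hBq : B = C * θ ^ 2 := by rw [hθ'e] at hBC; field_simp at hBC; linear_combination hBC
  -- `σ₀ := τ⁻¹ τ′ ∈ Z_H(t)`, `κ := k′ k⁻¹ ∈ K_H`, `r_i = σ₀ r_j κ`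
  set σ₀ : ↥(Subgroup.centralizer ({c} : Set ↥(unitaryGroupOfForm σ J))) := τ⁻¹ * τ' with hσ₀
  set κ : ↥(Subgroup.centralizer ({c} : Set ↥(unitaryGroupOfForm σ J))) := k' * k⁻¹ with hκ
  have hrel : r i = σ₀ * r j * κ := by
    rw [hσ₀, hκ]
    have : τ⁻¹ * (τ * r i * k) * k⁻¹ = τ⁻¹ * (τ' * r j * k') * k⁻¹ := by rw [heq]
    simpa [mul_assoc, mul_inv_cancel_left, inv_mul_cancel_left] using this
  have hσ₀Z : σ₀ ∈ Subgroup.centralizer ({⟨t, htH⟩} : Set ↥(Subgroup.centralizer ({c} : Set ↥(unitaryGroupOfForm σ J)))) :=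
    Subgroup.mul_mem _ (Subgroup.inv_mem _ hτ) hτ'
  have hκK : κ ∈ (flickerKH σ J c).subgroupOf (Subgroup.centralizer ({c} : Set ↥(unitaryGroupOfForm σ J))) :=
    Subgroup.mul_mem _ hk' (Subgroup.inv_mem _ hk)
  -- block shapes
  obtain ⟨p, β₀, q, δ₀, e₀, hσ₀M⟩ := exists_coe_eq_block_of_mem_centralizer σ h2 hc (σ₀ : ↥(Subgroup.centralizer _)).2
  obtain ⟨a, b, cc, e₁, e₂, hκM⟩ := exists_coe_eq_block_of_mem_centralizer σ h2 hc (κ : ↥(Subgroup.centralizer _)).2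
  -- `σ₀ ∈ Z(t)`: `p = δ₀`, `β₀ C = B q`
  have hσ₀t : (σ₀ : ↥(unitaryGroupOfForm σ J)) ∈ Subgroup.centralizer ({t} : Set ↥(unitaryGroupOfForm σ J)) := by
    rw [Subgroup.mem_centralizer_singleton_iff]
    have := Subgroup.mem_centralizer_singleton_iff.1 hσ₀Z
    exact congrArg Subtype.val this
  obtain ⟨hpδ, hβq⟩ := (mem_centralizer_block_iff σ hσ₀M hte hC).1 hσ₀t
  have hβ₀ : β₀ = θ ^ 2 * q := by
    have : β₀ * C = C * θ ^ 2 * q := by rw [hβq, hBq]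
    exact mul_right_cancel₀ hC (by linear_combination this)
  -- `κ ∈ K_H`: integral entries, and `|ae₁ − b·cc| = 1`
  have hκK' := (Subgroup.mem_subgroupOf.1 hκK)
  rw [mem_flickerKH_iff] at hκK'
  have hκint := (mem_unitaryInt_iff_forall_v_apply_le_one σ hJ hd.vσ _).1 hκK'.2
  have hva : Valued.v a ≤ 1 := by have := hκint 0 0; rwa [hκM] at this
  have hve₁ : Valued.v e₁ ≤ 1 := by have := hκint 2 2; rwa [hκM] at this
  have hvcc : Valued.v cc ≤ 1 := by have := hκint 2 0; rwa [hκM] at this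
  have hκ3 : (((κ : ↥(Subgroup.centralizer _)) : ↥(unitaryGroupOfForm σ J)) : GL (Fin 3) K) ∈
      unitaryGroupOfForm σ ((StdForm.antidiagonal 3).over K) := by
    rw [← hJ]; exact ((κ : ↥(Subgroup.centralizer _)) : ↥(unitaryGroupOfForm σ J)).2
  have hσ₀3 : (((σ₀ : ↥(Subgroup.centralizer _)) : ↥(unitaryGroupOfForm σ J)) : GL (Fin 3) K) ∈
      unitaryGroupOfForm σ ((StdForm.antidiagonal 3).over K) := by
    rw [← hJ]; exact ((σ₀ : ↥(Subgroup.centralizer _)) : ↥(unitaryGroupOfForm σ J)).2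
  -- `|det corner| = 1` for `κ` and `σ₀` (★ γ0: `(αδ − βγ)·σl = l`)
  have hvdet : ∀ {h : GL (Fin 3) K} {α β γ δ e : K}, h ∈ unitaryGroupOfForm σ ((StdForm.antidiagonal 3).over K) →
      (h : Matrix (Fin 3) (Fin 3) K) = !![α, 0, β; 0, e, 0; γ, 0, δ] → Valued.v (α * δ - β * γ) = 1 := by
    intro h α β γ δ e hh3 hh
    -- any `d` with `σd = −d ≠ 0` will do for γ0; use `d := x − σx` for a non-fixed `x`… we only need `hl`, which is `d`-free:
    obtain ⟨⟨R1, R2, R3, R4⟩, -⟩ := SplitDictionary.rel_of_coe_eq_block σ hh3 hh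
    have hΔ := SplitDictionary.det_mul_map_det σ R1 R2 R3 R4
    have h1 := congrArg Valued.v hΔ
    rw [map_mul, hd.vσ, map_one] at h1
    exact Literature.NumberTheory.QuadraticForms.OMeara65.WithZeroMulInt.eq_one_of_mul_self h1
  have hvΔκ : Valued.v (a * e₁ - b * cc) = 1 := hvdet hκ3 hκM
  have hvΔσ : Valued.v (p * δ₀ - β₀ * q) = 1 := hvdet hσ₀3 hσ₀M
  rw [← hpδ, hβ₀] at hvΔσ
  -- the matrix equation `r_i = σ₀ r_j κ`, corner entries
  have hM : (((r i : ↥(unitaryGroupOfForm σ J)) : GL (Fin 3) K) : Matrix (Fin 3) (Fin 3) K) =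
      (((σ₀ : ↥(Subgroup.centralizer _)) : ↥(unitaryGroupOfForm σ J)) : GL (Fin 3) K) *
        (((r j : ↥(unitaryGroupOfForm σ J)) : GL (Fin 3) K) : Matrix (Fin 3) (Fin 3) K) *
        (((κ : ↥(Subgroup.centralizer _)) : ↥(unitaryGroupOfForm σ J)) : GL (Fin 3) K) := by
    rw [← Units.val_mul, ← Units.val_mul, ← Subgroup.coe_mul, ← Subgroup.coe_mul, ← Subgroup.coe_mul, ← Subgroup.coe_mul, ← hrel]
  rw [hr i, hσ₀M, hr j, hκM, block_mul_block, block_mul_block, ← hpδ, hβ₀] at hM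
  have E00 : (ϖ ^ i)⁻¹ = p * (ϖ ^ j)⁻¹ * a + θ ^ 2 * q * ϖ ^ j * cc := by
    have := congrArg (fun M : Matrix (Fin 3) (Fin 3) K => M 0 0) hM; simp at this; linear_combination this
  have E02 : (0 : K) = p * (ϖ ^ j)⁻¹ * b + θ ^ 2 * q * ϖ ^ j * e₁ := by
    have := congrArg (fun M : Matrix (Fin 3) (Fin 3) K => M 0 2) hM; simp at this; linear_combination this
  have E20 : (0 : K) = q * (ϖ ^ j)⁻¹ * a + p * ϖ ^ j * cc := by
    have := congrArg (fun M : Matrix (Fin 3) (Fin 3) K => M 2 0) hM; simp at this; linear_combination this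
  have E22 : ϖ ^ i = q * (ϖ ^ j)⁻¹ * b + p * ϖ ^ j * e₁ := by
    have := congrArg (fun M : Matrix (Fin 3) (Fin 3) K => M 2 2) hM; simp at this; linear_combination this
  have hϖi0 : ϖ ^ i ≠ 0 := pow_ne_zero _ hϖ0
  have hϖj0 : ϖ ^ j ≠ 0 := pow_ne_zero _ hϖ0
  -- `a ϖ^i = ϖ^j p Δ`, `e₁ ϖ^j = ϖ^i p Δ`, `cc ϖ^{i+j} = −q Δ`
  have hA : a * ϖ ^ i = ϖ ^ j * p * (a * e₁ - b * cc) := by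
    have h1 := E22; have h2 := E20
    field_simp at h1 h2
    refine mul_right_cancel₀ hϖj0 ?_
    linear_combination a * h1 - b * h2
  have hE : e₁ * ϖ ^ j = ϖ ^ i * p * (a * e₁ - b * cc) := by
    have h1 := E00; have h2 := E02
    field_simp at h1 h2
    linear_combination e₁ * h1 - (ϖ ^ i * cc) * h2
  have hCq : cc * ϖ ^ (i + j) = -(q * (a * e₁ - b * cc)) := by
    have h1 := E22; have h2 := E20
    field_simp at h1 h2
    rw [pow_add]
    linear_combination cc * h1 - e₁ * h2
  -- valuations
  by_contra hij
  have hvϖ := hd.vϖ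
  have key : Valued.v (p * p - θ ^ 2 * q * q) < 1 := by
    have hvq : Valued.v (θ * q) < 1 := by
      -- `|q| = |cc|·|ϖ|^{i+j} ≤ |ϖ|^{i+j}` with `i + j ≥ 1`
      have h1 : Valued.v cc * Valued.v (ϖ ^ (i + j)) = Valued.v q := by
        have := congrArg Valued.v hCq
        rw [map_mul, Valuation.map_neg, map_mul, hvΔκ, mul_one] at this
        exact this
      have hij1 : 1 ≤ i + j := by omega
      calc Valued.v (θ * q) = Valued.v θ * Valued.v q := map_mul _ _ _
        _ ≤ 1 * Valued.v q := mul_le_mul_left hvθ _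
        _ = Valued.v cc * Valued.v (ϖ ^ (i + j)) := by rw [one_mul, h1]
        _ ≤ 1 * Valued.v (ϖ ^ (i + j)) := mul_le_mul_left hvcc _
        _ < 1 := by rw [one_mul]; exact v_pow_lt_one hvϖ hij1
    have hvp : Valued.v p < 1 := by
      rcases Nat.lt_or_gt_of_ne hij with hlt | hgt
      · -- `i < j`: use `e₁ ϖ^j = ϖ^i p Δ` ⇒ `|p| = |e₁| |ϖ|^{j−i} < 1`
        obtain ⟨n, hn⟩ := Nat.exists_eq_add_of_lt hlt
        have h1 : Valued.v e₁ * Valued.v (ϖ ^ (n + 1)) = Valued.v p := by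
          have := congrArg Valued.v hE
          rw [hn, map_mul, map_mul, map_mul, hvΔκ, mul_one, show i + n + 1 = i + (n + 1) by ring, pow_add, map_mul] at this
          have hvi : Valued.v (ϖ ^ i) ≠ 0 := (Valuation.ne_zero_iff _).2 hϖi0
          calc Valued.v e₁ * Valued.v (ϖ ^ (n + 1)) = (Valued.v e₁ * (Valued.v (ϖ ^ i) * Valued.v (ϖ ^ (n + 1)))) / Valued.v (ϖ ^ i) := by
                field_simp
            _ = Valued.v (ϖ ^ i) * Valued.v p / Valued.v (ϖ ^ i) := by rw [this]
            _ = Valued.v p := by field_simp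
        calc Valued.v p = Valued.v e₁ * Valued.v (ϖ ^ (n + 1)) := h1.symm
          _ ≤ 1 * Valued.v (ϖ ^ (n + 1)) := mul_le_mul_left hve₁ _
          _ < 1 := by rw [one_mul]; exact v_pow_lt_one hvϖ (by omega)
      · -- `j < i`: use `a ϖ^i = ϖ^j p Δ`
        obtain ⟨n, hn⟩ := Nat.exists_eq_add_of_lt hgt
        have h1 : Valued.v a * Valued.v (ϖ ^ (n + 1)) = Valued.v p := by
          have := congrArg Valued.v hA
          rw [hn, map_mul, map_mul, map_mul, hvΔκ, mul_one, show j + n + 1 = j + (n + 1) by ring, pow_add, map_mul] at this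
          have hvj : Valued.v (ϖ ^ j) ≠ 0 := (Valuation.ne_zero_iff _).2 hϖj0
          calc Valued.v a * Valued.v (ϖ ^ (n + 1)) = (Valued.v a * (Valued.v (ϖ ^ j) * Valued.v (ϖ ^ (n + 1)))) / Valued.v (ϖ ^ j) := by
                field_simp
            _ = Valued.v (ϖ ^ j) * Valued.v p / Valued.v (ϖ ^ j) := by rw [this]
            _ = Valued.v p := by field_simp
        calc Valued.v p = Valued.v a * Valued.v (ϖ ^ (n + 1)) := h1.symm
          _ ≤ 1 * Valued.v (ϖ ^ (n + 1)) := mul_le_mul_left hva _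
          _ < 1 := by rw [one_mul]; exact v_pow_lt_one hvϖ (by omega)
    have e1 : p * p - θ ^ 2 * q * q = p * p - (θ * q) * (θ * q) := by ring
    rw [e1]
    refine Valuation.map_sub_lt _ ?_ ?_
    · rw [map_mul]; exact Left.mul_lt_one' hvp hvp
    · rw [map_mul]; exact Left.mul_lt_one' hvq hvq
  exact absurd hvΔσ (ne_of_lt key)

end Literature.NumberTheory.Automorphic.UnitaryGroup
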